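import Literature.AlgebraicGeometry.Frobenioids.Frobenioid
import HarnessLib

/-!
# Frobenioids I, proof of Theorem 3.4 (v): every base morphism factors as
# `Base(ψ) ∘ Base(γ) ∘ Base(α)⁻¹` (pre-steps `α`, `γ`, pull-back morphism `ψ`)

Mochizuki, *The geometry of Frobenioids I: the general theory*, Kyushu J. Math. **62** (2008)
293–400, proof of Thm. 3.4 (v), kurims p. 68 ll. 22–26 [cite: MochizukiFrdI2008, Thm. 3.4 (v) p.68]:

> "Next, let us observe that if `A, A' ∈ Ob(C_i)`, `A_D := Base(A)`, `A'_D := Base(A')`, then any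
> morphism `φ_D : A_D → A'_D` may be written in the form `φ_D = Base(ψ) ∘ Base(γ) ∘ Base(α)⁻¹` —
> where `α : B → A`, `γ : B → C` are pre-steps; `ψ : C → A'` is a pull-back morphism [cf. Definition
> 1.3, (i), (b), (c)]."

PROOF-ONLY file (seat abc-iut-L1-d4 gen 2; first brick "L13a" of the sub-node FrdI:Thm3.4(v)/L13
`PsiBaseFunctor` of plan/L1/SUBDAG-FrdI-Thm34.md — the presentation of the arrows of `D` through
which `Ψ^Base` is defined). Over abc-iut-found's Def. 1.3 API (`IsFrobenioid.i_b`, `i_c`,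
`pullbackSliceToBase`): (c) gives the pull-back morphism `ψ : X → A'` with `Base X ≅ A_D` over `A'_D`,
(b) rewrites that base-isomorphism through two pre-steps. Nothing of [FrdI] is restated.
-/

namespace Literature.AlgebraicGeometry.Frobenioids

open CategoryTheory Opposite

universe w v v' u u'

namespace PreFrobenioid

variable {D : Type u} [Category.{v} D] {Φ : Dᵒᵖ ⥤ CommMonCat.{w}}
  {C : Type u'} [Category.{v'} C] {F : C ⥤ ElemFrobenioid Φ}

/-- **[FrdI] proof of Thm. 3.4 (v), p. 68 ll. 22–26**: in a Frobenioid every morphism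
`f : A_D → A'_D` between base objects factors as `Base(ψ) ∘ Base(γ) ∘ Base(α)⁻¹` with `α : B → A`,
`γ : B → X` pre-steps and `ψ : X → A'` a pull-back morphism — here in the composition-order form
`Base(α) ≫ f = Base(γ) ≫ Base(ψ)` (`Base(α)` is an isomorphism, `α` being a pre-step).
[cite: MochizukiFrdI2008, Thm. 3.4 (v) p.68] -/
theorem exists_base_factorisation (hF : IsFrobenioid F) {A A' : C} (f : baseObj F A ⟶ baseObj F A') :
    ∃ (B X : C) (α : B ⟶ A) (γ : B ⟶ X) (ψ : X ⟶ A'),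
      IsPreStep F α ∧ IsPreStep F γ ∧ IsPullbackMorphism F ψ ∧ Base F α ≫ f = Base F γ ≫ Base F ψ := by
  let T := pullbackSliceToBase F A'
  haveI : T.IsEquivalence := hF.i_c A'
  -- the object `(A_D, f)` of `D_{A'_D}` and a pull-back morphism `ψ : X → A'` over it (Def. 1.3 (i)(c))
  let V : Over ((wideSubcategoryInclusion (pullbackMorphisms F) ⋙ baseFunctor F).obj ⟨A'⟩) := Over.mk f
  let W := T.objPreimage V
  let i : T.obj W ≅ V := T.objObjPreimageIso V
  have hψ : IsPullbackMorphism F W.hom.hom := W.hom.property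
  -- the base-isomorphism `Base X ≅ A_D` over `A'_D`
  let e : baseObj F W.left.obj ≅ baseObj F A := (Over.forget _).mapIso i
  have he : e.hom ≫ f = Base F W.hom.hom := Over.w i.hom
  -- Def. 1.3 (i)(b): `e = Base(α) ∘ Base(γ)⁻¹` for pre-steps `γ : B → X`, `α : B → A`
  obtain ⟨B, γ, α, hγ, hα, hB⟩ := hF.i_b W.left.obj A e
  refine ⟨B, W.left.obj, α, γ, W.hom.hom, hα, hγ, hψ, ?_⟩
  rw [← hB, Category.assoc, he]

/-- The same factorisation read as an equation of morphisms `f = Base(α)⁻¹ ≫ Base(γ) ≫ Base(ψ)` in `D`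
(`Base(α)` inverted as the isomorphism underlying the pre-step `α`).
[cite: MochizukiFrdI2008, Thm. 3.4 (v) p.68] -/
theorem exists_base_factorisation' (hF : IsFrobenioid F) {A A' : C} (f : baseObj F A ⟶ baseObj F A') :
    ∃ (B X : C) (α : B ⟶ A) (γ : B ⟶ X) (ψ : X ⟶ A') (_ : IsPreStep F α) (_ : IsPreStep F γ)
      (_ : IsPullbackMorphism F ψ) (_ : IsIso (Base F α)),
      f = inv (Base F α) ≫ Base F γ ≫ Base F ψ := by
  obtain ⟨B, X, α, γ, ψ, hα, hγ, hψ, h⟩ := exists_base_factorisation hF f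
  haveI : IsIso (Base F α) := hα.2
  exact ⟨B, X, α, γ, ψ, hα, hγ, hψ, inferInstance, by rw [← h, IsIso.inv_hom_id_assoc]⟩

end PreFrobenioid

end Literature.AlgebraicGeometry.Frobenioids
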